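import Summits.ValiantsHypothesis.ValiantsHypothesis.Theses.RigidMinimalReps
import Summits.ValiantsHypothesis.ValiantsHypothesis.Theorems.RigidMinimalRepsExpDcGlue

/-!
# Route RigidMinimalReps — assembly (item `stmt-ValiantsHypothesis-5117`)

`Assembly := MinimalRepTorusSymmetric → TorusBound → ValiantsHypothesis`.

Pure bookkeeping over results proved in the tree:

* `grenet_le_dc_per_of_torus` — X (`MinimalRepTorusSymmetric`: for `n ≥ n₀` the permanent `per_n`
  has a two-sided-torus-equivariant affine determinantal representation of size exactly
  `dc(per_n)`) and `TorusBound` (for `n ≥ 3` every such representation has size `≥ 2 ^ n - 1`)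
  give Grenet's bound `2 ^ n - 1 ≤ dc(per_n)` for all `n ≥ max n₀ 3`.
* `three_pow_add_two_pow_le_four_pow`, `three_halves_pow_le_two_pow_sub_one` — the elementary
  estimate `(3/2) ^ n ≤ 2 ^ n - 1` (`n ≥ 2`), i.e. `3 ^ n + 2 ^ n ≤ 4 ^ n`.
* `exists_exp_le_dc_per_of_torus` — hence the eventual REAL exponential lower bound
  `(3/2) ^ n ≤ dc(per_n)` (`n ≥ max n₀ 3`), which is verbatim the hypothesis of the route's support
  item `ExpDcGlue` (and the target `DcPerExponential` of the closed route `GrenetRigidity`).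
* `assembly_proof` — `ExpDcGlue` is proved in the tree
  (`Summit.ValiantsHypothesis.Theorems.expDcGlue_proof`, `Theorems/RigidMinimalRepsExpDcGlue.lean`:
  `VP ⟹ dc quasi-polynomially bounded` (Bürgisser–Clausen–Shokrollahi 1997, Cor. (21.40)),
  `per ∈ VNP` (Valiant 1979) and the hub lemma), so the exponential bound yields `VP ℂ ≠ VNP ℂ`.

No unproved Literature fact is a hypothesis anywhere; the deciding theorem `closes` of the route file
proves the same implication by an independent `ℕ`-arithmetic argument and is deliberately NOT used
here (route files are regenerated by the gate).
-/

namespace Summit.ValiantsHypothesis.Theorems.RigidMinimalReps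

open Literature.Computability.AlgebraicComplexity
open Summit.ValiantsHypothesis.ValiantsHypothesis.Theses.RigidMinimalReps

/-- **X + TorusBound ⇒ Grenet's bound eventually.** If for all `n ≥ n₀` the permanent `per_n` has a
two-sided-torus-equivariant affine determinantal representation of size `dc(per_n)`
(`MinimalRepTorusSymmetric`) and every such representation of `per_n`, `n ≥ 3`, has size
`≥ 2 ^ n - 1` (`TorusBound`), then `2 ^ n - 1 ≤ dc(per_n)` for all `n ≥ max n₀ 3`. [folklore] -/
theorem grenet_le_dc_per_of_torus (hX : MinimalRepTorusSymmetric) (hT : TorusBound) :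
    ∃ n₀ : ℕ, ∀ n ≥ n₀, 2 ^ n - 1 ≤ determinantalComplexity (perPoly (Fin n) ℂ) := by
  obtain ⟨n₀, hn₀⟩ := hX
  refine ⟨max n₀ 3, fun n hn => ?_⟩
  obtain ⟨A, hA⟩ := hn₀ n (le_of_max_le_left hn)
  exact hT n (le_of_max_le_right hn) _ A hA

/-- `3 ^ n + 2 ^ n ≤ 4 ^ n` for `n ≥ 2` (induction: `3·3ⁿ + 2·2ⁿ ≤ 3(3ⁿ + 2ⁿ) ≤ 3·4ⁿ ≤ 4ⁿ⁺¹`).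
[folklore] -/
theorem three_pow_add_two_pow_le_four_pow {n : ℕ} (hn : 2 ≤ n) : 3 ^ n + 2 ^ n ≤ 4 ^ n := by
  induction n, hn using Nat.le_induction with
  | base => norm_num
  | succ n _ ih =>
    rw [pow_succ, pow_succ, pow_succ]
    omega

/-- `(3/2) ^ n ≤ 2 ^ n - 1` over `ℝ` for `n ≥ 2` (divide `3 ^ n ≤ 4 ^ n - 2 ^ n` by `2 ^ n`).
[folklore] -/
theorem three_halves_pow_le_two_pow_sub_one {n : ℕ} (hn : 2 ≤ n) :
    ((3 : ℝ) / 2) ^ n ≤ (2 : ℝ) ^ n - 1 := by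
  have h : ((3 ^ n + 2 ^ n : ℕ) : ℝ) ≤ ((4 ^ n : ℕ) : ℝ) :=
    Nat.cast_le.mpr (three_pow_add_two_pow_le_four_pow hn)
  push_cast at h
  have h4 : (4 : ℝ) ^ n = 2 ^ n * 2 ^ n := by
    rw [← mul_pow]; norm_num
  have h2 : (0 : ℝ) < 2 ^ n := pow_pos two_pos n
  rw [div_pow, div_le_iff₀ h2]
  nlinarith [h, h4]

/-- **X + TorusBound ⇒ an eventual exponential lower bound on `dc(per_n)`** (the hypothesis of
`ExpDcGlue`, equivalently the target `DcPerExponential` of route `GrenetRigidity`), with the explicit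
base `c = 3/2`: `(3/2) ^ n ≤ 2 ^ n - 1 ≤ dc(per_n)` for `n ≥ max n₀ 3`. [folklore] -/
theorem exists_exp_le_dc_per_of_torus (hX : MinimalRepTorusSymmetric) (hT : TorusBound) :
    ∃ c : ℝ, 1 < c ∧ ∃ n₀ : ℕ, ∀ n ≥ n₀,
      c ^ n ≤ (determinantalComplexity (perPoly (Fin n) ℂ) : ℝ) := by
  obtain ⟨n₀, hn₀⟩ := grenet_le_dc_per_of_torus hX hT
  refine ⟨3 / 2, by norm_num, max n₀ 2, fun n hn => ?_⟩
  have hdc : 2 ^ n - 1 ≤ determinantalComplexity (perPoly (Fin n) ℂ) :=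
    hn₀ n (le_of_max_le_left hn)
  have hcast : ((2 ^ n - 1 : ℕ) : ℝ) ≤ (determinantalComplexity (perPoly (Fin n) ℂ) : ℝ) :=
    Nat.cast_le.mpr hdc
  have hsub : ((2 ^ n - 1 : ℕ) : ℝ) = (2 : ℝ) ^ n - 1 := by
    rw [Nat.cast_sub Nat.one_le_two_pow]
    push_cast
    ring
  calc ((3 : ℝ) / 2) ^ n ≤ (2 : ℝ) ^ n - 1 :=
        three_halves_pow_le_two_pow_sub_one (le_of_max_le_right hn)
    _ = ((2 ^ n - 1 : ℕ) : ℝ) := hsub.symm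
    _ ≤ _ := hcast

/-- **Settles item `stmt-ValiantsHypothesis-5117`** (`RigidMinimalReps.Assembly`, stated verbatim):
`MinimalRepTorusSymmetric → TorusBound → ValiantsHypothesis`. X and `TorusBound` give the eventual
exponential lower bound `(3/2) ^ n ≤ dc(per_n)` (`exists_exp_le_dc_per_of_torus`), and the route's
support item `ExpDcGlue`, proved in the tree as `Summit.ValiantsHypothesis.Theorems.expDcGlue_proof`
(`VP ⟹ dc qp-bounded`, `per ∈ VNP`, hub), turns it into `VP ℂ ≠ VNP ℂ`. [folklore] -/
theorem assembly_proof :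
    Summit.ValiantsHypothesis.ValiantsHypothesis.Theses.RigidMinimalReps.Assembly := by
  unfold Summit.ValiantsHypothesis.ValiantsHypothesis.Theses.RigidMinimalReps.Assembly
  intro hX hT
  have hglue := Summit.ValiantsHypothesis.Theorems.expDcGlue_proof
  unfold Summit.ValiantsHypothesis.ValiantsHypothesis.Theses.RigidMinimalReps.ExpDcGlue at hglue
  exact hglue (exists_exp_le_dc_per_of_torus hX hT)

end Summit.ValiantsHypothesis.Theorems.RigidMinimalReps
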